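import Summits.QuantumFields.BalabanUV.Beta.FP.NestedStepLawTorusCompositeOneShotTopSym
import Summits.QuantumFields.BalabanUV.Beta.FP.NestedStepLawTorusCompositeOneShotTopGB
import Summits.QuantumFields.BalabanUV.Beta.FP.RelInvPeriodisedCombTorusLetters
import Summits.QuantumFields.BalabanUV.Beta.FP.RelInvPeriodisedCombRecord

/-!
# BOUNDED-LEVELS TWIN `NestedStepLawTorusCompositeOneShotTopSymB` (R-FP-76, the repair of E-FP-34-1, journal l.64955): the statements and proofs of `NestedStepLawTorusCompositeOneShotTopSym` VERBATIM but for the displayed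
# clause `hlev : ∀ i, i ≤ n → lev i = lev (i + 1) + 1` (the original `∀ i, lev i = lev (i + 1) + 1` is unsatisfiable for `lev : ℕ → ℕ`, so the original theorem is
# vacuous — kernel-proved, `HOME/b2b-balaban-beta-d1-p3/g34/hlev/HlevVacuous.lean`) and the `B` suppliers; helper lemmas without `hlev` are imported from the
# original, not re-declared.  Generator `HOME/b2b-balaban-beta-d1-p3/g34/recut/recutB.py` over the TREE bytes.  Road «FP» OWNER d1-p3 gen 34, 2026-08-25.  ORIGINAL HEADER:
# `BalabanUV.Beta.FP.NestedStepLawTorusCompositeOneShotTopSym` — road «FP» for binder row D1, ROUTE T under RULING R-D1-g52-1 (β1) ∕ R-FP-70: **THE (j, m ≥ 2) TORUS CALL OF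
# THE (0.4)-SYMMETRISED COMPOSITE TOWER WITH `uTop` AS ITS ONLY SLICE-SIDE LETTER — THE SYM DOOR's INPUT** (#21-G at `Q := QSym Lc`, `K ℓ _ := bhKStepSh d Lc (Dsh Lc) ℓ`,
# roots `ctrOff (d+1) Lc`; `hH₀t ∕ hone ∕ hId ∕ htop` DISCHARGED by leaf-05's chart-(III′) letters; `hSL ∕ c0 ∕ hTW ∕ d0` displayed for leaf-02's ∕ leaf-06's sym rows — R-FP-71)

WHY (R-D1-g52-1 (3)(b)(c)): the re-based tower's door — #41c-Sym reads THIS theorem by term exactly as #41c reads #21.  Pins: leaf-06 `TorusCompositeObjectsG` §3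
(`compRowsSym`), the finest form and the top step's rows = the field block ∕ the slot rows of an1's shifted straight spread `bhKStepSh d Lc (Dsh Lc) ℓ` periodised, roots
`ctrOff` everywhere (so `hrs : ∀ k, ctrOff (d+1) Lc ∈ box (d+1) Lc` is a formality the caller meets by `AveragingContoursRooted.ctrOff_mem_box`); inside: `H₀ᵀ = H₀`
(`RelInvPeriodisedCombTorusLetters.torus_H₀_transpose_comb`), (INV-m)(EFF-m)'s one-step letters (`torus_h1_comb ∕ hId_comb`), the top comb-KKT
(`RelInvPeriodisedCombRecord.torus_isUnit_det_kkt_combRows_comb`).  DISPLAYED for the sym suppliers: `a0 : H₀ * W₀ = 0` (the finest form's field block is brick-free —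
the rooted `torus_a0_tower`'s sum, an1∕leaf-02 to name the sym spelling), `hSL ∕ c0 ∕ hTW` (R-FP-71 «display what you use», v1.2: the LOWER sym tower's nested-slice transversality — leaf-06's G-1 sym theorem —, leaf-02's
(COV-m) order 0 for `compRowsSym` AT THE TOP DEPTH in the pinned letters — R-20 `compRowsSym_mul_towerGen_succ` at the constant root list —, and the
one-shot slice's transversality — leaf-06 G-2 §2; v1.1's universal-in-`ρs` family `hc0` was unsatisfiable off the centred root list, leaf-02 g31 W-1 l.56632),
`d0` (the top sym step's order 0), and #21's rows `c1 c2 d1 d2 k1 k2 q1 q2 a1 a2 hH₁t hH₂t uTop` + namings.  [folklore] ONE instantiation BY NAME; no `def`, no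
`def … : Prop`, nothing cited, 0 sorry.  Nothing of the dictionary ∕ Bałaban's asserted (the presentation is the row's (β1) ruling, quoted).  No existing file touched.

HONEST DEPENDENCY (page 1, mandatory): continuum YM on T⁴ ⇐ BetaPertH ∧ nine spine estimates (0/9 proved); BetaPertH ⇐ (D1) ∧ (D4) ∧ CAP+tail;
G-an2-4 gates asym, D1 and NE2/3/4.  HONEST FRAMING (cell contract, verbatim): «discharging `BetaPertH` makes Bałaban's UV stability UNCONDITIONAL —
a real constructive-QFT result; it is NOT the continuum limit and NOT the Clay problem.»  ABSOLUTE RULE (cell charter, verbatim): «No internally-minted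
statement may enter as a cited fact. Every hypothesis is either kernel-proved in this package or a verbatim quotation of a PUBLISHED theorem with page
reference. The manuscript(s) under audit are NOT citable for their own disputed steps — they are the thing under adjudication; programme-internal
(2001/route/tribunal) claims are never citable.»  0 estimates; 0∕4 row-D1 binders (hW, hR, D1Tel, D1Rep); ROOT M‴ p325680 untouched; NOT (C1), NOT (L2′),
NOT (T-ID), NOT SDF, NOT D1, NOT BetaPertH, NOT continuum, NOT Clay.  Road «FP» OWNER, b2b-balaban-beta-d1-p3 gen 29, 2026-08-24.  No existing file touched.
-/

noncomputable section

namespace Summit.QuantumFields.BalabanUV.Beta.FP.NestedStepLawTorusCompositeOneShotTopSymB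

open Matrix
open Literature.MathematicalPhysics.QuantumFieldTheory.Balaban1983to89
open Literature.MathematicalPhysics.QuantumFieldTheory.Balaban1983to89.Beta
open Literature.MathematicalPhysics.QuantumFieldTheory.Balaban1983to89.Beta.Composition (kkt)
open Literature.MathematicalPhysics.QuantumFieldTheory.Balaban1983to89.Beta.CompositionSingular (effForm flucCov minOp minOpL)
open B5Prop11Plancherel (fine)
open B6Lemma24Torus (pbox mem_pbox)
open AffineAveraging (Site box toSite)
open OneStepResolventKernel (Fib)
open Summit.QuantumFields.BalabanUV.Beta.BorderedHessian (bhKStepAt)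
open Summit.QuantumFields.BalabanUV.Beta.AxialDressingRooted (IsCombBondAt)
open Summit.QuantumFields.BalabanUV.Beta.D1BFx.LogDetSecondVariation (secondVar)
open Summit.QuantumFields.BalabanUV.Beta.FP.KernelPeriodisationFib (Idx perF perF_apply perZ perZ_apply trF perF_transpose)
open Summit.QuantumFields.BalabanUV.Beta.FP.TorusCombRows (Res)
open Summit.QuantumFields.BalabanUV.Beta.FP.CompositeWardLetters (compWard_b0 compWard_b1 compWard_b2)
open Summit.QuantumFields.BalabanUV.Beta.FP.NestedStepLawTransported (secondVar_nestedFP_eq_zero)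
open Summit.QuantumFields.BalabanUV.Beta.FP.NestedStepLawTransportedExpGraded (secondVar_oneShot_nestedStepLaw_expTransported_graded_of_uni)
open Summit.QuantumFields.BalabanUV.Beta.FP.TorusCompositeObjects (towerTorus towerTorus_apply compRows nestedSlice NParam Qstep combF bigP towerGen
  towerGen_succ bigRoot bigRatio bigRatio_pos bigRatio_eq_pow pboxCongr pboxCongr_coe)
open Summit.QuantumFields.BalabanUV.Beta.FP.TorusCompositeUnimodular (det_bigP_mul_towerGen_ne_zero)
open Summit.QuantumFields.BalabanUV.Beta.FP.TorusCompositeFP (evalN torus_uP_exp_tower)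
open Summit.QuantumFields.BalabanUV.Beta.FP.TorusCompositeIntertwining (towerC₁ torus_j1_tower torus_j2_tower)
open Summit.QuantumFields.BalabanUV.Beta.FP.TorusGeneratorIntertwining (torus_uC_exp)
open Summit.QuantumFields.BalabanUV.Beta.FP.TorusGaugeCovariance (tgrad)
open Summit.QuantumFields.BalabanUV.Beta.FP.NestedStepLawTorusComposite (H₀_transpose_of_dvd dvd_towerTorus_succ)
open Summit.QuantumFields.BalabanUV.Beta.GAN24.FineReadoutCauchyFrame (toSite_mem_range)
open AffineAveraging (unitVec)
open Summit.QuantumFields.BalabanUV.Beta.FP.TorusEffFormComposite (torus_composite_inv_and_eff)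
open Summit.QuantumFields.BalabanUV.Beta.FP.RelInvPeriodisedCoarse (det_kkt_smul_form_ne_zero_iff)
open Summit.QuantumFields.BalabanUV.Beta.FP.RelInvPeriodisedCombRows (torus_isUnit_det_kkt_combRows)
open Summit.QuantumFields.BalabanUV.Beta.FP.RelInvPeriodisedEffFormCoarse (wVH_pos)
open Summit.QuantumFields.BalabanUV.Beta.FP.NestedStepLawTorusInstance (dvd_fine)
open Summit.QuantumFields.BalabanUV.Beta.FP.TorusCompositeSlice (det_nestedSlice_mul_towerGen_ne_zero torus_t1_tower_of_c1 torus_t2_tower_of_c2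
  det_combF_mul_smul_tgrad_res_ne_zero prod_stepScale_mul_card_ne_zero)
open Summit.QuantumFields.BalabanUV.Beta.FP.NestedFPSplit (secondVar_nestedFP_eq_zero_of_blocks)
open Summit.QuantumFields.BalabanUV.Beta.FP.TorusCompositeCovariance (compRows_mul_towerGen_succ Qtop_mul_smul_tgrad_res)
open Summit.QuantumFields.BalabanUV.Beta.FP.PeriodisedWardOrderZero (sum_perZ_bhKStepAt_ff_mul_tgrad sum_perZ_bhKStepAt_ff_mul_grad_periodic abs_tdelta_le)
open Summit.QuantumFields.BalabanUV.Beta.FP.TorusGaugeCovariance (tdelta)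
open Summit.QuantumFields.BalabanUV.Beta.FP.TorusGaugeCovarianceCoarse (tgradBlock tgradBlock_inl tdelta_quo_congr)
open Summit.QuantumFields.BalabanUV.Beta.BorderedHessian (stepScale)
open Literature.MathematicalPhysics.QuantumFieldTheory.LatticeForm (quo)
open Literature.MathematicalPhysics.QuantumFieldTheory.Balaban1983to89.B4TorusKernel.MultiPeriod (translate_apply)
open Summit.QuantumFields.BalabanUV.Beta.FP.TorusCompositeSliceOneShot (torus_hTW_oneShot_tower torus_uLow_oneShot_tower)
open Literature.MathematicalPhysics.QuantumFieldTheory.Balaban1983to89.Beta.GaugeFixingPropagators (isUnit_det_kkt_sliceChange₃ blocks_sliceChange₃)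
open Literature.Probability.LatticeModels (Torus.proj)
open BalabanStepJetsSucc (wVH)
open Finset
open Summit.QuantumFields.BalabanUV.Beta.FP.NestedStepLawTorusCompositeOneShot (torus_a0_tower)
open Summit.QuantumFields.BalabanUV.Beta.FP.TorusCompositeObjectsG (StepRows compRowsG nestedSliceG QstepSym QSym compRowsSym nestedSliceSym)
open Summit.QuantumFields.BalabanUV.Beta.FP.NestedStepLawTorusCompositeOneShotTopGB (secondVar_oneShot_nestedStepLaw_torus_composite_graded_oneShot_of_uTop_G)
open Summit.QuantumFields.BalabanUV.Beta.SymShiftedSpread (bhKStepSh bhKStepSh_apply)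
open Summit.QuantumFields.BalabanUV.Beta.BorderedHessian (bhKStep bhKStep_zero bhKStepAt_zero bhKAt bhKAt_inl_inl)
open Summit.QuantumFields.BalabanUV.Beta.DshAn1 (Dsh Dsh_inl_inl)
open Summit.QuantumFields.BalabanUV.Beta.FP.RelInvPeriodisedCombTorusLetters (torus_h1_comb hId_comb torus_H₀_transpose_comb)
open Summit.QuantumFields.BalabanUV.Beta.FP.RelInvPeriodisedCombRecord (torus_isUnit_det_kkt_combRows_comb)
open AveragingContoursRooted (ctrOff ctrOff_mem_box)
open ExpKernelCalculus (MKer)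

open Summit.QuantumFields.BalabanUV.Beta.FP.NestedStepLawTorusCompositeOneShotTopSym (bhKStepSh_Dsh_inl_inl_eq_bhKStepAt)
variable {d : ℕ}

section FieldBlock

variable (Lc : ℕ) [NeZero Lc]

end FieldBlock

section CompositeOneShotTopSym

variable (M' : Fin (d + 1) → ℕ) [∀ μ, NeZero (M' μ)] (Lc : ℕ) [NeZero Lc] (lev : ℕ → ℕ) (n : ℕ)

set_option synthInstance.maxSize 1024 in
/-- [folklore] **THE SYM DOOR's INPUT**: #21-G `…_of_uTop_G` at `Q := QSym Lc`, `K ℓ _ := bhKStepSh d Lc (Dsh Lc) ℓ`, roots `ctrOff (d+1) Lc`; `hH₀t hone hId htop`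
discharged by leaf-05's chart-(III′) letters (top step in (B)'s slot presentation); `hSL c0 hTW d0` and #21's rows displayed (R-FP-71). -/
theorem secondVar_oneShot_nestedStepLaw_torus_composite_graded_oneShot_of_uTop_sym (hrs : ∀ _k : ℕ, ctrOff (d + 1) Lc ∈ box (d + 1) Lc)
    (hlev : ∀ i, i ≤ n → lev i = lev (i + 1) + 1)
    (hM' : ∀ i, Lc ∣ M' i)
    -- the coarse multipliers' slot presentation one level above `M′` (as (B): injective, `inr`-valued, exactly the `Lc`-coarse sites of `M′`)
    {κ : Type*} [Fintype κ] [DecidableEq κ] (pμ' : κ → ↥(pbox M')) (mμ' : κ → Fin (d + 1))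
    (hfμ' : Function.Injective (fun a : κ => ((pμ' a, Sum.inr (mμ' a)) : Idx M' (Fib d))))
    (hcoarse' : ∀ (s : ↥(pbox M')) (m : Fin (d + 1)),
      ((s, Sum.inr m) : Idx M' (Fib d)) ∈ Set.range (fun a : κ => ((pμ' a, Sum.inr (mμ' a)) : Idx M' (Fib d))) ↔ Torus.proj Lc (s : Site (d + 1)) = 0)
    -- the (0.4)-SYMMETRISED composite objects PINNED (leaf-06 `TorusCompositeObjectsG` §3), roots `ctrOff (d+1) Lc` at every storey
    {H₀ : Matrix (↥(pbox (towerTorus Lc M' (n + 1))) × Fin (d + 1)) (↥(pbox (towerTorus Lc M' (n + 1))) × Fin (d + 1)) ℝ}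
    {Q₁₀ : Matrix (↥(pbox M') × Fin (d + 1)) (↥(pbox (towerTorus Lc M' (n + 1))) × Fin (d + 1)) ℝ}
    {τ₁ : Matrix (NParam Lc (fine Lc M') (fun k => (fun _ : ℕ => ctrOff (d + 1) Lc) (k + 1)) n) (↥(pbox (towerTorus Lc M' (n + 1))) × Fin (d + 1)) ℝ}
    (hH₀ : H₀ = (perF (towerTorus Lc M' (n + 1)) (bhKStepSh d Lc (Dsh Lc) (lev (n + 1)))).submatrix
        (fun b : ↥(pbox (towerTorus Lc M' (n + 1))) × Fin (d + 1) => ((b.1, Sum.inl b.2) : Idx (towerTorus Lc M' (n + 1)) (Fib d)))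
        (fun b : ↥(pbox (towerTorus Lc M' (n + 1))) × Fin (d + 1) => ((b.1, Sum.inl b.2) : Idx (towerTorus Lc M' (n + 1)) (Fib d))))
    (hQ₁₀ : Q₁₀ = compRowsSym Lc M' lev (fun _ : ℕ => ctrOff (d + 1) Lc) (n + 1))
    -- R-FP-55 (α): the fine slice is the ONE-SHOT big comb of the tower below (leaf-06 `bigP`), NOT the nested slice
    (hτ₁ : τ₁ = bigP Lc (fine Lc M') (fun k => (fun _ : ℕ => ctrOff (d + 1) Lc) (k + 1)) (fun k => toSite_mem_range (hrs (k + 1))) n)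
    -- (SLICE-m) OF THE TOWER BELOW `M′`, DISPLAYED (R-FP-71 «display what you use»): its NESTED comb slice is transversal to its generators
    -- (rooted: leaf-06 `TorusCompositeSlice.det_nestedSlice_mul_towerGen_ne_zero`; sym: leaf-06's G-1 sym theorem at the constant root list, fed leaf-02's R-20)
    (hSL : (nestedSliceSym Lc (fine Lc M') (fun k => lev (k + 1)) (fun k => (fun _ : ℕ => ctrOff (d + 1) Lc) (k + 1)) n
        * towerGen Lc (fine Lc M') (fun k => (fun _ : ℕ => ctrOff (d + 1) Lc) (k + 1)) n).det ≠ 0)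
    {τ₂ : Matrix (Res (toSite (ctrOff (d + 1) Lc)) Lc M') (↥(pbox M') × Fin (d + 1)) ℝ} (hτ₂ : τ₂ = combF Lc M' ((fun _ : ℕ => ctrOff (d + 1) Lc) 0))
    -- the top step's (0.4)-symmetrised averaging rows (level `lev 0`), PINNED in (B)'s slot presentation
    {Q₂₀ : Matrix κ (↥(pbox M') × Fin (d + 1)) ℝ}
    (hQ₂₀ : Q₂₀ = (perF M' (bhKStepSh d Lc (Dsh Lc) (lev 0))).submatrix (fun a : κ => ((pμ' a, Sum.inr (mμ' a)) : Idx M' (Fib d)))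
        (fun b : ↥(pbox M') × Fin (d + 1) => ((b.1, Sum.inl b.2) : Idx M' (Fib d))))
    -- the tower's generators and the one-shot big comb: FREE matrices of the tower's types in v1 (pinned to leaf-06's `towerGen ∕ bigP` by the (SLICE-m) ∕
    -- (COV-m) suppliers in v1.1; target shape 36f428fe4d8b64c2)
    {W₀ : Matrix (↥(pbox (towerTorus Lc M' (n + 1))) × Fin (d + 1)) (NParam Lc M' (fun _ : ℕ => ctrOff (d + 1) Lc) (n + 1)) ℝ} (hW₀ : W₀ = towerGen Lc M' (fun _ : ℕ => ctrOff (d + 1) Lc) (n + 1))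
    {P : Matrix (NParam Lc M' (fun _ : ℕ => ctrOff (d + 1) Lc) (n + 1)) (↥(pbox (towerTorus Lc M' (n + 1))) × Fin (d + 1)) ℝ} (hP : P = bigP Lc M' (fun _ : ℕ => ctrOff (d + 1) Lc) (fun k => toSite_mem_range (hrs k)) (n + 1))
    -- the displayed jets: form (finest level), composite averaging, the top step's averaging jets, generators, witnesses, composite covariance images
    (H₁ H₂ : Matrix (↥(pbox (towerTorus Lc M' (n + 1))) × Fin (d + 1)) (↥(pbox (towerTorus Lc M' (n + 1))) × Fin (d + 1)) ℝ)
    (Q₁₁ Q₁₂ : Matrix (↥(pbox M') × Fin (d + 1)) (↥(pbox (towerTorus Lc M' (n + 1))) × Fin (d + 1)) ℝ)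
    (Q₂₁ Q₂₂ : Matrix κ (↥(pbox M') × Fin (d + 1)) ℝ)
    -- the finest-level transport generator `X = −c·diag(λ)`, the tower's generator jets `W₁ W₂` (weight `h`) and the one-shot generator jets `W′₁ W′₂`
    -- (weight `h + Dλ`) PINNED to the exponential closed forms of leaf-06's `TorusCompositeIntertwining` ∕ `TorusCompositeFP` (parameters `λ`, `c`, `h`)
    (lam : ↥(pbox (towerTorus Lc M' (n + 1))) → ℝ) (c : ℝ) (h : (↥(pbox (towerTorus Lc M' (n + 1))) × Fin (d + 1)) → ℝ)
    {W₁ W₂ : Matrix (↥(pbox (towerTorus Lc M' (n + 1))) × Fin (d + 1)) (NParam Lc M' (fun _ : ℕ => ctrOff (d + 1) Lc) (n + 1)) ℝ}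
    (hW₁ : W₁ = Matrix.of fun (b : (↥(pbox (towerTorus Lc M' (n + 1))) × Fin (d + 1))) (e : NParam Lc M' (fun _ : ℕ => ctrOff (d + 1) Lc) (n + 1)) => -(c * h b * evalN Lc M' (fun _ : ℕ => ctrOff (d + 1) Lc) (n + 1) (fun b' : (↥(pbox (towerTorus Lc M' (n + 1))) × Fin (d + 1)) => (b'.1 : Site (d + 1)) + unitVec b'.2) b e))
    (hW₂ : W₂ = Matrix.of fun (b : (↥(pbox (towerTorus Lc M' (n + 1))) × Fin (d + 1))) (e : NParam Lc M' (fun _ : ℕ => ctrOff (d + 1) Lc) (n + 1)) => (c * h b) ^ 2 * evalN Lc M' (fun _ : ℕ => ctrOff (d + 1) Lc) (n + 1) (fun b' : (↥(pbox (towerTorus Lc M' (n + 1))) × Fin (d + 1)) => (b'.1 : Site (d + 1)) + unitVec b'.2) b e)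
    -- (COV-m) ORDER 0 PINNED (leaf-02 g21 `TorusCompositeCovariance`): `Dbar := σ_{n+1} • D̄`; the orders 1, 2 images stay displayed
    {Dbar : Matrix (↥(pbox M') × Fin (d + 1)) (Res (toSite (ctrOff (d + 1) Lc)) Lc M') ℝ}
    (hDbar : Dbar = (∏ i ∈ range (n + 1), (stepScale d Lc (lev (i + 1)) * ((box (d + 1) Lc).card : ℝ))) •
        (tgrad M').submatrix (fun a : ↥(pbox M') × Fin (d + 1) => ((a.1, Sum.inl a.2) : Idx M' (Fib d))) (fun t : Res (toSite (ctrOff (d + 1) Lc)) Lc M' => (t.1 : ↥(pbox M'))))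
    -- (COV-m) ORDER 0 AT THE TOP DEPTH in the pinned letters and the ONE-SHOT slice's transversality, DISPLAYED (R-FP-71; rooted: leaf-02
    -- `TorusCompositeCovariance.compRows_mul_towerGen_succ` ∕ leaf-06 `TorusCompositeSliceOneShot.torus_hTW_oneShot_tower`; sym: leaf-02's R-20
    -- `compRowsSym_mul_towerGen_succ` at the constant root list ∕ leaf-06 G-2 §2 `torus_hTW_oneShot_towerSym` fed R-20)
    (c0 : Q₁₀ * W₀ = fromCols Dbar (0 : Matrix (↥(pbox M') × Fin (d + 1)) (NParam Lc (fine Lc M') (fun k => (fun _ : ℕ => ctrOff (d + 1) Lc) (k + 1)) n) ℝ))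
    (hTW : (Matrix.fromRows (τ₂ * Q₁₀) τ₁ * W₀).det ≠ 0)
    (Db₁ Db₂ : Matrix (↥(pbox M') × Fin (d + 1)) (Res (toSite (ctrOff (d + 1) Lc)) Lc M') ℝ)
    (Y₁ Y₂ : Matrix κ (NParam Lc M' (fun _ : ℕ => ctrOff (d + 1) Lc) (n + 1)) ℝ)
    -- the chart transport (exponential currency): generators `X` (finest fields), `X̄` (coarse multipliers); one-shot chart's generator jets; parameter-transport jets
    {X : Matrix (↥(pbox (towerTorus Lc M' (n + 1))) × Fin (d + 1)) (↥(pbox (towerTorus Lc M' (n + 1))) × Fin (d + 1)) ℝ} (hX : X = -(c • Matrix.diagonal (fun b : (↥(pbox (towerTorus Lc M' (n + 1))) × Fin (d + 1)) => lam b.1))) (Xbar : Matrix κ κ ℝ)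
    {W'₁ W'₂ : Matrix (↥(pbox (towerTorus Lc M' (n + 1))) × Fin (d + 1)) (NParam Lc M' (fun _ : ℕ => ctrOff (d + 1) Lc) (n + 1)) ℝ}
    (hW'₁ : W'₁ = Matrix.of fun (b : (↥(pbox (towerTorus Lc M' (n + 1))) × Fin (d + 1))) (e : NParam Lc M' (fun _ : ℕ => ctrOff (d + 1) Lc) (n + 1)) =>
        -(c * (h b + ∑ s, tgrad (towerTorus Lc M' (n + 1)) (b.1, Sum.inl b.2) s * lam s) * evalN Lc M' (fun _ : ℕ => ctrOff (d + 1) Lc) (n + 1) (fun b' : (↥(pbox (towerTorus Lc M' (n + 1))) × Fin (d + 1)) => (b'.1 : Site (d + 1)) + unitVec b'.2) b e))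
    (hW'₂ : W'₂ = Matrix.of fun (b : (↥(pbox (towerTorus Lc M' (n + 1))) × Fin (d + 1))) (e : NParam Lc M' (fun _ : ℕ => ctrOff (d + 1) Lc) (n + 1)) =>
        (c * (h b + ∑ s, tgrad (towerTorus Lc M' (n + 1)) (b.1, Sum.inl b.2) s * lam s)) ^ 2 * evalN Lc M' (fun _ : ℕ => ctrOff (d + 1) Lc) (n + 1) (fun b' : (↥(pbox (towerTorus Lc M' (n + 1))) × Fin (d + 1)) => (b'.1 : Site (d + 1)) + unitVec b'.2) b e)
    {C₁ C₂ : Matrix (NParam Lc M' (fun _ : ℕ => ctrOff (d + 1) Lc) (n + 1)) (NParam Lc M' (fun _ : ℕ => ctrOff (d + 1) Lc) (n + 1)) ℝ} (hC₁ : C₁ = c • towerC₁ Lc M' (fun _ : ℕ => ctrOff (d + 1) Lc) (fun k => toSite_mem_range (hrs k)) (n + 1) lam) (hC₂ : C₂ = C₁ * C₁)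
    {𝔔₀ 𝔔₁ 𝔔₂ : Matrix κ (↥(pbox (towerTorus Lc M' (n + 1))) × Fin (d + 1)) ℝ}
    (h𝔔₀ : Q₂₀ * Q₁₀ = 𝔔₀) (h𝔔₁ : Q₂₁ * Q₁₀ + Q₂₀ * Q₁₁ = 𝔔₁) (h𝔔₂ : Q₂₂ * Q₁₀ + Q₂₁ * Q₁₁ + (Q₂₁ * Q₁₁ + Q₂₀ * Q₁₂) = 𝔔₂)
    -- (T-β-m) GRADED: the one-shot literal's composite jets are the graded `X`-conjugated words, NAMED
    {H'₁ H'₂ : Matrix (↥(pbox (towerTorus Lc M' (n + 1))) × Fin (d + 1)) (↥(pbox (towerTorus Lc M' (n + 1))) × Fin (d + 1)) ℝ}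
    {𝔔'₁ 𝔔'₂ : Matrix κ (↥(pbox (towerTorus Lc M' (n + 1))) × Fin (d + 1)) ℝ}
    (k1 : -(Xᵀ * H₀) + H₁ + H₀ * X = H'₁)
    (k2 : (X * X)ᵀ * H₀ + (-(Xᵀ * H₁) + -(Xᵀ * H₀ * X)) + ((-(Xᵀ * H₁) + -(Xᵀ * H₀ * X)) + (H₂ + H₁ * X + (H₁ * X + H₀ * (X * X)))) = H'₂)
    (q1 : Xbar * 𝔔₀ + 𝔔₁ + 𝔔₀ * X = 𝔔'₁)
    (q2 : Xbar * Xbar * 𝔔₀ + (Xbar * 𝔔₁ + Xbar * 𝔔₀ * X) + ((Xbar * 𝔔₁ + Xbar * 𝔔₀ * X) + (𝔔₂ + 𝔔₁ * X + (𝔔₁ * X + 𝔔₀ * (X * X)))) = 𝔔'₂)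
    -- (T-β-4) `j1 j2 uC` DISCHARGED (leaf-06 `TorusCompositeIntertwining.torus_j1_tower ∕ torus_j2_tower`, `TorusGeneratorIntertwining.torus_uC_exp`)
    -- (INV-m) `h1` and (EFF-m) `h2` follow INSIDE from `hone hId htop` by leaf-05 `TorusEffFormCompositeG.torus_composite_inv_and_eff_G`
    -- slice by an2's Literature `GaugeFixingPropagators.isUnit_det_kkt_sliceChange₃ ∕ blocks_sliceChange₃` (R-FP-55 (R3))
    {Γ : Matrix (↥(pbox (towerTorus Lc M' (n + 1))) × Fin (d + 1)) (↥(pbox (towerTorus Lc M' (n + 1))) × Fin (d + 1)) ℝ}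
    {I : Matrix (↥(pbox (towerTorus Lc M' (n + 1))) × Fin (d + 1)) ((↥(pbox M') × Fin (d + 1)) ⊕ NParam Lc (fine Lc M') (fun k => (fun _ : ℕ => ctrOff (d + 1) Lc) (k + 1)) n) ℝ}
    {L : Matrix ((↥(pbox M') × Fin (d + 1)) ⊕ NParam Lc (fine Lc M') (fun k => (fun _ : ℕ => ctrOff (d + 1) Lc) (k + 1)) n) (↥(pbox (towerTorus Lc M' (n + 1))) × Fin (d + 1)) ℝ}
    {S : Matrix ((↥(pbox M') × Fin (d + 1)) ⊕ NParam Lc (fine Lc M') (fun k => (fun _ : ℕ => ctrOff (d + 1) Lc) (k + 1)) n)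
      ((↥(pbox M') × Fin (d + 1)) ⊕ NParam Lc (fine Lc M') (fun k => (fun _ : ℕ => ctrOff (d + 1) Lc) (k + 1)) n) ℝ}
    {B : Matrix ((↥(pbox M') × Fin (d + 1)) ⊕ NParam Lc (fine Lc M') (fun k => (fun _ : ℕ => ctrOff (d + 1) Lc) (k + 1)) n) (↥(pbox (towerTorus Lc M' (n + 1))) × Fin (d + 1)) ℝ}
    (hΓ : flucCov H₀ (fromRows Q₁₀ τ₁) = Γ) (hI : minOp H₀ (fromRows Q₁₀ τ₁) = I) (hL : minOpL H₀ (fromRows Q₁₀ τ₁) = L) (hS : effForm H₀ (fromRows Q₁₀ τ₁) = S)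
    (hB : fromRows Q₁₁ (0 : Matrix (NParam Lc (fine Lc M') (fun k => (fun _ : ℕ => ctrOff (d + 1) Lc) (k + 1)) n) (↥(pbox (towerTorus Lc M' (n + 1))) × Fin (d + 1)) ℝ) = B)
    -- (SLICE-m) ALL DISCHARGED but ONE primitive letter (R-FP-56): `hPW uP'` (leaf-06 g20), `hTW` (leaf-06 g21), the nested Faddeev–Popov 2-jet `uT` by
    -- leaf-06 g21's SPLIT `NestedFPSplit.secondVar_nestedFP_eq_zero_of_blocks` (block lower-triangular under `c0 c1 c2`; fine block `uLow` AUTOMATIC —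
    -- `torus_uLow_oneShot_tower`; coarse block = THIS letter); DISPLAYED: «the coarse chart's Faddeev–Popov 2-jet along the composite insertion jets'
    -- coarse images vanishes» — produced by `CoarseFPExponential.torus_uTop_of_sq_on_comb ∕ _of_exp_on_comb ∕ _of_dead` or `CoarseFPDefect` (leaf-06 g22)
    (uTop : secondVar (τ₂ * Dbar) (τ₂ * Db₁) (τ₂ * Db₂) = 0)
    -- parities of the displayed form jets; the GRADED Ward rows of the finest form against the composite witnesses (NO transposed rows)
    (hH₁t : H₁ᵀ = -H₁) (hH₂t : H₂ᵀ = H₂)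
    -- (WARD-m) ORDER 0 `a0` DISCHARGED inside (§0: the sym kernel's field block IS the rooted one's; #20 §1 `torus_a0_tower`); orders 1, 2 at `Y₀ := 0`
    (a1 : H₁ * W₀ + H₀ * W₁ = 𝔔₀ᵀ * Y₁)
    (a2 : H₂ * W₀ + (2 : ℝ) • (H₁ * W₁) + H₀ * W₂ = -((2 : ℝ) • (𝔔₁ᵀ * Y₁)) + 𝔔₀ᵀ * Y₂)
    -- (COV-m) ORDERS 1, 2 displayed (order 0 `c0` above); the top step's order 0 `d0` DISPLAYED (rooted: `Qtop_mul_smul_tgrad_res`)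
    (d0 : Q₂₀ * Dbar = 0)
    (c1 : Q₁₁ * W₀ + Q₁₀ * W₁ = fromCols Db₁ (0 : Matrix (↥(pbox M') × Fin (d + 1)) (NParam Lc (fine Lc M') (fun k => (fun _ : ℕ => ctrOff (d + 1) Lc) (k + 1)) n) ℝ))
    (c2 : Q₁₂ * W₀ + (2 : ℝ) • (Q₁₁ * W₁) + Q₁₀ * W₂ = fromCols Db₂ (0 : Matrix (↥(pbox M') × Fin (d + 1)) (NParam Lc (fine Lc M') (fun k => (fun _ : ℕ => ctrOff (d + 1) Lc) (k + 1)) n) ℝ))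
    (d1 : Q₂₁ * Dbar + Q₂₀ * Db₁ = 0) (d2 : Q₂₂ * Dbar + (2 : ℝ) • (Q₂₁ * Db₁) + Q₂₀ * Db₂ = 0) :
    secondVar (kkt H₀ (fromRows 𝔔₀ P))
        (fromBlocks H'₁ (-(fromRows 𝔔'₁ (0 : Matrix (NParam Lc M' (fun _ : ℕ => ctrOff (d + 1) Lc) (n + 1)) (↥(pbox (towerTorus Lc M' (n + 1))) × Fin (d + 1)) ℝ))ᵀ)
          (fromRows 𝔔'₁ (0 : Matrix (NParam Lc M' (fun _ : ℕ => ctrOff (d + 1) Lc) (n + 1)) (↥(pbox (towerTorus Lc M' (n + 1))) × Fin (d + 1)) ℝ)) 0)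
        (kkt H'₂ (fromRows 𝔔'₂ (0 : Matrix (NParam Lc M' (fun _ : ℕ => ctrOff (d + 1) Lc) (n + 1)) (↥(pbox (towerTorus Lc M' (n + 1))) × Fin (d + 1)) ℝ)))
      = secondVar (kkt H₀ (fromRows Q₁₀ τ₁)) (fromBlocks H₁ (-Bᵀ) B 0)
            (kkt H₂ (fromRows Q₁₂ (0 : Matrix (NParam Lc (fine Lc M') (fun k => (fun _ : ℕ => ctrOff (d + 1) Lc) (k + 1)) n) (↥(pbox (towerTorus Lc M' (n + 1))) × Fin (d + 1)) ℝ)))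
        + secondVar
            (kkt S.toBlocks₁₁ (fromRows Q₂₀ τ₂))
            (fromBlocks ((L * H₁ - S * B) * I + L * Bᵀ * S).toBlocks₁₁ (-(fromRows Q₂₁ (0 : Matrix (Res (toSite (ctrOff (d + 1) Lc)) Lc M') (↥(pbox M') × Fin (d + 1)) ℝ))ᵀ)
              (fromRows Q₂₁ (0 : Matrix (Res (toSite (ctrOff (d + 1) Lc)) Lc M') (↥(pbox M') × Fin (d + 1)) ℝ)) 0)
            (kkt (((-((L * H₁ - S * B) * Γ - L * Bᵀ * L) * H₁ + L * H₂
                      - (((L * H₁ - S * B) * I + L * Bᵀ * S) * B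
                          + S * fromRows Q₁₂ (0 : Matrix (NParam Lc (fine Lc M') (fun k => (fun _ : ℕ => ctrOff (d + 1) Lc) (k + 1)) n) (↥(pbox (towerTorus Lc M' (n + 1))) × Fin (d + 1)) ℝ))) * I
                    + (L * H₁ - S * B) * (-((Γ * H₁ + I * B) * I + Γ * Bᵀ * S)))
                  - ((-((L * H₁ - S * B) * Γ - L * Bᵀ * L) * (-Bᵀ)
                        + L * (fromRows Q₁₂ (0 : Matrix (NParam Lc (fine Lc M') (fun k => (fun _ : ℕ => ctrOff (d + 1) Lc) (k + 1)) n) (↥(pbox (towerTorus Lc M' (n + 1))) × Fin (d + 1)) ℝ))ᵀ) * S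
                      + L * (-Bᵀ) * ((L * H₁ - S * B) * I + L * Bᵀ * S))).toBlocks₁₁
              (fromRows Q₂₂ (0 : Matrix (Res (toSite (ctrOff (d + 1) Lc)) Lc M') (↥(pbox M') × Fin (d + 1)) ℝ))) := by
  exact secondVar_oneShot_nestedStepLaw_torus_composite_graded_oneShot_of_uTop_G M' Lc lev (fun _ : ℕ => ctrOff (d + 1) Lc) n (QSym Lc)
    (fun ℓ _ => bhKStepSh d Lc (Dsh Lc) ℓ) hrs hlev hM' (hH₀ := hH₀) (hQ₁₀ := hQ₁₀) (hτ₁ := hτ₁)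
    (hH₀t := by
      rw [hH₀]
      exact torus_H₀_transpose_comb (towerTorus Lc M' (n + 1)) (dvd_towerTorus_succ (Lc := Lc) M' n) (lev (n + 1)))
    (hone := fun k T _ => torus_h1_comb T (lev k))
    (hId := fun k T _ _ => hId_comb T (lev k))
    (Q₂₀ := Q₂₀)
    (htop := by
      rw [hQ₂₀, hτ₂]
      exact (torus_isUnit_det_kkt_combRows_comb M' hM' (lev 0) _ hfμ' (fun a => ⟨mμ' a, rfl⟩) hcoarse').ne_zero)
    (hSL := hSL)
    (hτ₂ := hτ₂)
    (hW₀ := hW₀)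
    (hP := hP)
    (H₁ := H₁)
    (H₂ := H₂)
    (Q₁₁ := Q₁₁)
    (Q₁₂ := Q₁₂)
    (Q₂₁ := Q₂₁)
    (Q₂₂ := Q₂₂)
    (lam := lam)
    (c := c)
    (h := h)
    (hW₁ := hW₁)
    (hW₂ := hW₂)
    (hDbar := hDbar)
    (c0 := c0)
    (hTW := hTW)
    (Db₁ := Db₁)
    (Db₂ := Db₂)
    (Y₁ := Y₁)
    (Y₂ := Y₂)
    (hX := hX)
    (Xbar := Xbar)
    (hW'₁ := hW'₁)
    (hW'₂ := hW'₂)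
    (hC₁ := hC₁)
    (hC₂ := hC₂)
    (h𝔔₀ := h𝔔₀)
    (h𝔔₁ := h𝔔₁)
    (h𝔔₂ := h𝔔₂)
    (k1 := k1)
    (k2 := k2)
    (q1 := q1)
    (q2 := q2)
    (hΓ := hΓ)
    (hI := hI)
    (hL := hL)
    (hS := hS)
    (hB := hB)
    (uTop := uTop)
    (hH₁t := hH₁t)
    (hH₂t := hH₂t)
    (a0 := by
      have hH₀' : H₀ = (perF (towerTorus Lc M' (n + 1)) (bhKStepAt d (toSite (ctrOff (d + 1) Lc)) Lc (lev (n + 1)))).submatrix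
          (fun b : ↥(pbox (towerTorus Lc M' (n + 1))) × Fin (d + 1) => ((b.1, Sum.inl b.2) : Idx (towerTorus Lc M' (n + 1)) (Fib d)))
          (fun b : ↥(pbox (towerTorus Lc M' (n + 1))) × Fin (d + 1) => ((b.1, Sum.inl b.2) : Idx (towerTorus Lc M' (n + 1)) (Fib d))) := by
        rw [hH₀]; ext p q
        simp only [Matrix.submatrix_apply, perF_apply, perZ_apply]
        exact tsum_congr fun m => bhKStepSh_Dsh_inl_inl_eq_bhKStepAt Lc (toSite (ctrOff (d + 1) Lc)) (lev (n + 1)) _ _ _ _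
      exact torus_a0_tower Lc M' lev (fun _ : ℕ => ctrOff (d + 1) Lc) n hrs hH₀' hW₀)
    (a1 := a1)
    (a2 := a2)
    (d0 := d0)
    (c1 := c1)
    (c2 := c2)
    (d1 := d1)
    (d2 := d2)

end CompositeOneShotTopSym

end Summit.QuantumFields.BalabanUV.Beta.FP.NestedStepLawTorusCompositeOneShotTopSymB

end
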